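/-
Copyright: cell pub-balaban-gaps (YM BLITZ Y1, track G1), seat g1-p2 GEN 12 (unit `pub-balaban-gaps-g1-p2`).  Row (D4) NODE O,
MECHANISM level — ROAD (c′) of g1-plan-1 GEN 39 ([G1-PLAN1-G39-PRECISION-110] (ψ2)–(ψ3), step (vi)): the SUM OVER THE CUBES of a
partition of block walk expansions LOCALIZED behind the partition (`Σ_□ h_□G_□h_□` of (3.87), `Σ_□ K(h_□)G_□h_□` of (3.88)) is ONE
block walk expansion whose constant is the overlap letter of the partition times the common constant — NO volume factor —, with
the derivative letters and dominating distances inherited.  HONEST FRAMING: [folklore] bookkeeping over `D4WalkBlock.BlockWalkExpansion`;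
the partition, its penalties and the per-cube expansions are data; nothing of Bałaban's `Δ^{(k)}(𝐔)` is constructed; words of row
(D4) UNCHANGED (`ExistsUniformAcrossSmall` + `TermDomination`, OBJECT level); (D4) instance 0∕1; NOT BetaPertH, NOT continuum, NOT Clay.
-/
import Summits.QuantumFields.BalabanUV.Gaps.D4WalkBlock

/-!
# `Gaps.D4WalkBlockPartitionSum` — a sum over a partition of localized block walk expansions is a block walk expansion
# (cell pub-balaban-gaps, seat g1-p2 gen 12)

HONEST DEPENDENCY (cell pub-balaban, verbatim): continuum YM on T⁴ ⇐ BetaPertH ∧ nine spine estimates (0/9 proved);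
BetaPertH ⇐ (D1) ∧ (D4) ∧ CAP+tail.

[B9] (3.87) p. 409 `G′₀ = Σ_□ h_□G′_□h_□`, (3.88)–(3.90) `R′ = Σ_□ K(h_□)G′_□h_□`, p. 410 «a term … depends on U restricted to
□̃₀ ∪ … ∪ □̃_j».  For each cube `b` of a finite index set a block walk expansion `K_b = Σ_ω T_{b,ω}` at common rates
`(ε, κ, K̄, ρ)` whose terms' blocks live where a PENALTY `pen_b ≥ 0` vanishes (the cubes of `supp h_b`), and the OVERLAP LETTER
`Σ_b e^{−(ρ−ε)pen_b(a)} ≤ N` of the partition (a cube meets boundedly many `supp h_b`, each of bounded size):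
* §1 `blockNorm_eq_zero_of_rows` ∕ `blockNorm_eq_zero_of_cols` (how the instance discharges the localization);
* §2 **`blockWalkExpansion_sum_localized`**: `Σ_b K_b` is a block walk expansion on the walks `Σ b, W_b` with the SAME amplitudes,
  distances `D_{b,ω} + pen_b(y) + pen_b(y′)`, rates `(ε, κ, ρ)` and constant `N·K̄`; `domBy_sum_localized`;
  **`derivLetters_sum_localized`** (relative derivative letters pass unchanged).
WHAT IT IS NOT.  The per-cube expansions (66 ∕ `D4WalkBlockTruncationWindows` + gauge conjugation), the penalties of an actual partition
and its overlap letter from the cube row sum, the step (3.88)–(3.90) (55 `blockWalkExpansion_perturb`): separate files; OBJECT level untouched.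

References (method only): T. Bałaban, Comm. Math. Phys. **99** (1985) 389–434 [B9], (3.87)–(3.90) p. 409, (3.92)–(3.94) p. 410,
(3.107)–(3.108) p. 416; Comm. Math. Phys. **116** (1988) [II], (1.11) p. 5, p. 13, p. 15.
-/

noncomputable section

namespace Summit.QuantumFields.BalabanUV.Gaps.D4WalkBlockPartitionSum

open Metric Set Finset
open Literature.MathematicalPhysics.QuantumFieldTheory.Balaban1983to89
open Literature.MathematicalPhysics.QuantumFieldTheory.Balaban1983to89.B9SectDWalk (Through MajSumLe DomBy)
open Literature.MathematicalPhysics.QuantumFieldTheory.Balaban1983to89.B9Thm34Ext (toB6)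
open Literature.MathematicalPhysics.QuantumFieldTheory.Balaban1983to89.B9Thm37GlueTorus (torusGeom tdist1)
open Literature.MathematicalPhysics.QuantumFieldTheory.Balaban1983to89.TreeLengthTorus (TPt)
open Literature.MathematicalPhysics.QuantumFieldTheory.Balaban1983to89.B5TorusCover (UT)
open Summit.QuantumFields.BalabanUV.Gaps.D4WalkBlock
  (rowMass blockNorm blockNorm_nonneg blockNorm_le_of_rowMass_le BlockWalkExpansion)

variable {ν : ℕ} {K : Fin ν → ℕ}

/-! ## §1. Localization of a block: vanishing rows ∕ columns -/

section Vanish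
variable {p n : Type} [Fintype p] [Fintype n] (cub : p → UT K) (cubn : n → UT K)

/-- If every row located in cube `y` vanishes, the blocks `(y, ·)` vanish. ([folklore]) -/
theorem blockNorm_eq_zero_of_rows (T : Matrix p n ℂ) {y : UT K} (h : ∀ i, cub i = y → ∀ j, T i j = 0) (y' : UT K) :
    blockNorm cub cubn T y y' = 0 := by
  refine le_antisymm (blockNorm_le_of_rowMass_le cub cubn T y y' le_rfl fun i hi => ?_) (blockNorm_nonneg cub cubn T y y')
  unfold rowMass
  exact (Finset.sum_eq_zero fun j _ => by rw [h i hi j, norm_zero]).le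

/-- If every column located in cube `y′` vanishes, the blocks `(·, y′)` vanish. ([folklore]) -/
theorem blockNorm_eq_zero_of_cols (T : Matrix p n ℂ) {y' : UT K} (h : ∀ j, cubn j = y' → ∀ i, T i j = 0) (y : UT K) :
    blockNorm cub cubn T y y' = 0 := by
  refine le_antisymm (blockNorm_le_of_rowMass_le cub cubn T y y' le_rfl fun i _ => ?_) (blockNorm_nonneg cub cubn T y y')
  unfold rowMass
  exact (Finset.sum_eq_zero fun j hj => by rw [h j (Finset.mem_filter.1 hj).2 i, norm_zero]).le

end Vanish

/-! ## §2. The sum over a partition of localized block walk expansions -/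

section Sum
variable {d N' : ℕ} [∀ i, NeZero (K i)]
variable {E : Type*} [NormedAddCommGroup E] [NormedSpace ℂ E]
variable {p n : Type} [Fintype p] [Fintype n]
variable {c : B13.Consts} {cub : p → UT K} {cubn : n → UT K} {X : Finset (UT K)} {R ε kap Kbar ρ : ℝ}
variable {B : Type} [Fintype B] [DecidableEq B]
variable {W : B → Type} {Kf : B → (TPt d N' → ℂ) → E → Matrix p n ℂ} {T : (b : B) → W b → (TPt d N' → ℂ) → E → Matrix p n ℂ}
variable {SX : (b : B) → Set (W b)} {A : (b : B) → W b → ℝ} {D : (b : B) → W b → UT K → UT K → ℝ}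
variable {pen : B → UT K → ℝ} {N : ℝ}

/-- **THE SUM OVER A PARTITION OF LOCALIZED BLOCK WALK EXPANSIONS IS A BLOCK WALK EXPANSION.**  For each `b`, `K_b(σ,u) = Σ_ω T_{b,ω}(σ,u)`
block-walk-expanded at common `(ε, κ, K̄, ρ)`, `ε ≤ ρ`, `K̄ ≥ 0`; penalties `pen_b ≥ 0` vanishing on every cube where a block of a term of `K_b` is
non-zero; overlap letter `Σ_b e^{−(ρ−ε)pen_b(a)} ≤ N` for every cube `a`.  Then `Σ_b K_b` is a block walk expansion on the walks
`⟨b, ω⟩` with terms `T_{b,ω}`, amplitudes `A_{b,ω}`, distances `D_{b,ω}(y,y′) + pen_b(y) + pen_b(y′)`, rates `(ε, κ, ρ)`, constant `N·K̄`,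
σ-carrying set `{⟨b,ω⟩ : ω ∈ SX_b}` — NO volume factor. [cite: Balaban1985BackgroundPropagators, (3.87)–(3.90) p.409, (3.92)–(3.94) p.410, (3.108) p.416; Balaban1988RG2Cluster, (1.11) p.5, p.15] -/
theorem blockWalkExpansion_sum_localized
    (h : ∀ b, BlockWalkExpansion c cub cubn (Kf b) X R ε kap Kbar (T b) (SX b) (A b) (D b) ρ) (hερ : ε ≤ ρ)
    (hKbar : 0 ≤ Kbar) (hpen0 : ∀ b y, 0 ≤ pen b y)
    (hloc : ∀ b ω (σ : TPt d N' → ℂ), (∀ j, ‖σ j‖ ≤ Real.exp c.κ₁) → ∀ u ∈ ball (0 : E) R, ∀ y y',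
      blockNorm cub cubn (T b ω σ u) y y' ≠ 0 → pen b y = 0 ∧ pen b y' = 0)
    (hN : ∀ a, ∑ b, Real.exp (-((ρ - ε) * pen b a)) ≤ N) :
    BlockWalkExpansion c cub cubn (fun σ u => ∑ b, Kf b σ u) X R ε kap (N * Kbar)
      (fun (x : Σ b, W b) σ u => T x.1 x.2 σ u) {x | x.2 ∈ SX x.1} (fun x => A x.1 x.2)
      (fun x y y' => D x.1 x.2 y y' + pen x.1 y + pen x.1 y') ρ where
  hasSum σ hσ u hu i j := by
    classical
    have hfib : ∀ b, HasSum (fun x : Σ b, W b => if x.1 = b then T x.1 x.2 σ u i j else 0) (Kf b σ u i j) := by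
      intro b
      have hinj : Function.Injective (Sigma.mk b : W b → Σ b, W b) := sigma_mk_injective
      refine (hinj.hasSum_iff ?_).1 ?_
      · intro x hx
        obtain ⟨b', ω⟩ := x
        rw [if_neg]
        rintro rfl
        exact hx ⟨ω, rfl⟩
      · have e : ((fun x : Σ b, W b => if x.1 = b then T x.1 x.2 σ u i j else 0) ∘ Sigma.mk b) = fun ω => T b ω σ u i j := by
          funext ω; simp
        rw [e]; exact (h b).hasSum σ hσ u hu i j
    have hsum := hasSum_sum (s := Finset.univ) fun b _ => hfib b
    simp only [Finset.sum_ite_eq, Finset.mem_univ, if_true] at hsum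
    rw [Matrix.sum_apply]
    exact hsum
  termAnalytic x σ hσ i j := (h x.1).termAnalytic x.2 σ hσ i j
  majB x σ hσ u hu y y' := by
    by_cases hz : blockNorm cub cubn (T x.1 x.2 σ u) y y' = 0
    · rw [hz]; exact mul_nonneg ((h x.1).A_nonneg x.2) (Real.exp_nonneg _)
    · obtain ⟨hy, hy'⟩ := hloc x.1 x.2 σ hσ u hu y y' hz
      rw [hy, hy', add_zero, add_zero]
      exact (h x.1).majB x.2 σ hσ u hu y y'
  majSum S a b' := by
    classical
    have hr : 0 ≤ ρ - ε := sub_nonneg.2 hερ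
    set t : (b : B) → Finset (W b) := fun b => S.preimage (Sigma.mk b) sigma_mk_injective.injOn with ht
    have hsub : S ⊆ Finset.univ.sigma t := by
      intro x hx
      rw [Finset.mem_sigma]
      refine ⟨Finset.mem_univ _, ?_⟩
      rw [ht, Finset.mem_preimage]
      exact hx
    have hF0 : ∀ x : Σ b, W b, 0 ≤ A x.1 x.2 * Real.exp (-((ρ - ε) * (D x.1 x.2 a b' + pen x.1 a + pen x.1 b'))) :=
      fun x => mul_nonneg ((h x.1).A_nonneg x.2) (Real.exp_nonneg _)
    have key : ∀ b (ω : W b), A b ω * Real.exp (-((ρ - ε) * (D b ω a b' + pen b a + pen b b'))) ≤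
        Real.exp (-((ρ - ε) * pen b a)) * (A b ω * Real.exp (-((ρ - ε) * D b ω a b'))) := by
      intro b ω
      have h1 : Real.exp (-((ρ - ε) * (D b ω a b' + pen b a + pen b b'))) ≤
          Real.exp (-((ρ - ε) * D b ω a b')) * Real.exp (-((ρ - ε) * pen b a)) := by
        rw [← Real.exp_add]
        exact Real.exp_le_exp.2 (by nlinarith [hpen0 b b', hpen0 b a])
      calc A b ω * Real.exp (-((ρ - ε) * (D b ω a b' + pen b a + pen b b')))
          ≤ A b ω * (Real.exp (-((ρ - ε) * D b ω a b')) * Real.exp (-((ρ - ε) * pen b a))) :=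
            mul_le_mul_of_nonneg_left h1 ((h b).A_nonneg ω)
        _ = Real.exp (-((ρ - ε) * pen b a)) * (A b ω * Real.exp (-((ρ - ε) * D b ω a b'))) := by ring
    have hKpos : 0 ≤ Kbar * Real.exp (-(kap * tdist1 K a b')) := mul_nonneg hKbar (Real.exp_nonneg _)
    calc ∑ x ∈ S, A x.1 x.2 * Real.exp (-((ρ - ε) * (D x.1 x.2 a b' + pen x.1 a + pen x.1 b')))
        ≤ ∑ x ∈ Finset.univ.sigma t, A x.1 x.2 * Real.exp (-((ρ - ε) * (D x.1 x.2 a b' + pen x.1 a + pen x.1 b'))) :=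
          Finset.sum_le_sum_of_subset_of_nonneg hsub fun x _ _ => hF0 x
      _ = ∑ b, ∑ ω ∈ t b, A b ω * Real.exp (-((ρ - ε) * (D b ω a b' + pen b a + pen b b'))) := Finset.sum_sigma _ _ _
      _ ≤ ∑ b, Real.exp (-((ρ - ε) * pen b a)) * (Kbar * Real.exp (-(kap * tdist1 K a b'))) := by
          refine Finset.sum_le_sum fun b _ => ?_
          calc ∑ ω ∈ t b, A b ω * Real.exp (-((ρ - ε) * (D b ω a b' + pen b a + pen b b')))
              ≤ ∑ ω ∈ t b, Real.exp (-((ρ - ε) * pen b a)) * (A b ω * Real.exp (-((ρ - ε) * D b ω a b'))) :=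
                Finset.sum_le_sum fun ω _ => key b ω
            _ = Real.exp (-((ρ - ε) * pen b a)) * ∑ ω ∈ t b, A b ω * Real.exp (-((ρ - ε) * D b ω a b')) := by
                rw [Finset.mul_sum]
            _ ≤ Real.exp (-((ρ - ε) * pen b a)) * (Kbar * Real.exp (-(kap * tdist1 K a b'))) :=
                mul_le_mul_of_nonneg_left ((h b).majSum (t b) a b') (Real.exp_nonneg _)
      _ = (∑ b, Real.exp (-((ρ - ε) * pen b a))) * (Kbar * Real.exp (-(kap * tdist1 K a b'))) := by rw [Finset.sum_mul]
      _ ≤ N * (Kbar * Real.exp (-(kap * tdist1 K a b'))) := mul_le_mul_of_nonneg_right (hN a) hKpos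
      _ = N * Kbar * Real.exp (-(kap * tdist1 K a b')) := by ring
  indep x hx σ hσ := (h x.1).indep x.2 hx σ hσ
  through x hx y y' := by
    obtain ⟨z, hz, hle⟩ := (h x.1).through x.2 hx y y'
    exact ⟨z, hz, hle.trans (by linarith [hpen0 x.1 y, hpen0 x.1 y'])⟩
  A_nonneg x := (h x.1).A_nonneg x.2
  D_nonneg x a b' := add_nonneg (add_nonneg ((h x.1).D_nonneg x.2 a b') (hpen0 _ _)) (hpen0 _ _)

omit [Fintype B] [DecidableEq B] in
/-- the sum's distances dominate the torus distance when the summands' do. ([folklore]) -/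
theorem domBy_sum_localized (hdom : ∀ b ω, DomBy (toB6 (torusGeom K 0 0 0) 0 True) (D b ω)) (hpen0 : ∀ b y, 0 ≤ pen b y) :
    ∀ x : Σ b, W b, DomBy (toB6 (torusGeom K 0 0 0) 0 True) (fun y y' => D x.1 x.2 y y' + pen x.1 y + pen x.1 y') :=
  fun x y y' => (hdom x.1 x.2 y y').trans (by linarith [hpen0 x.1 y, hpen0 x.1 y'])

omit [∀ i, NeZero (K i)] [NormedSpace ℂ E] [Fintype B] [DecidableEq B] in
/-- **RELATIVE DERIVATIVE LETTERS PASS TO THE SUM UNCHANGED**: if for every `b` the blocks of `∇_μT_{b,ω}` are `≤ B_μ·A_{b,ω}e^{−ρD_{b,ω}}`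
and live where `pen_b` vanishes, the sum's terms carry the letters `B_μ` against its own amplitudes and distances (the shape 55's
`blockWalkExpansion_perturb` consumes). [cite: Balaban1985BackgroundPropagators, Thm 3.1 (3.42) p.397, Cor. 3.6 p.408, (3.108) p.416] -/
theorem derivLetters_sum_localized {q : Type} [Fintype q] {cubq : q → UT K} {ι : Type*} (Dop : ι → Matrix q p ℂ) (Bμ : ι → ℝ)
    (hA : ∀ b ω, 0 ≤ A b ω)
    (hD : ∀ b μ ω (σ : TPt d N' → ℂ), (∀ j, ‖σ j‖ ≤ Real.exp c.κ₁) → ∀ u ∈ ball (0 : E) R, ∀ y y',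
      blockNorm cubq cubn (Dop μ * T b ω σ u) y y' ≤ Bμ μ * (A b ω * Real.exp (-(ρ * D b ω y y'))))
    (hDloc : ∀ b μ ω (σ : TPt d N' → ℂ), (∀ j, ‖σ j‖ ≤ Real.exp c.κ₁) → ∀ u ∈ ball (0 : E) R, ∀ y y',
      blockNorm cubq cubn (Dop μ * T b ω σ u) y y' ≠ 0 → pen b y = 0 ∧ pen b y' = 0)
    (hB : ∀ μ, 0 ≤ Bμ μ) :
    ∀ μ (x : Σ b, W b) (σ : TPt d N' → ℂ), (∀ j, ‖σ j‖ ≤ Real.exp c.κ₁) → ∀ u ∈ ball (0 : E) R, ∀ y y',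
      blockNorm cubq cubn (Dop μ * T x.1 x.2 σ u) y y' ≤
        Bμ μ * (A x.1 x.2 * Real.exp (-(ρ * (D x.1 x.2 y y' + pen x.1 y + pen x.1 y')))) := by
  intro μ x σ hσ u hu y y'
  by_cases hz : blockNorm cubq cubn (Dop μ * T x.1 x.2 σ u) y y' = 0
  · rw [hz]; exact mul_nonneg (hB μ) (mul_nonneg (hA x.1 x.2) (Real.exp_nonneg _))
  · obtain ⟨hy, hy'⟩ := hDloc x.1 μ x.2 σ hσ u hu y y' hz
    rw [hy, hy', add_zero, add_zero]
    exact hD x.1 μ x.2 σ hσ u hu y y'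

end Sum

end Summit.QuantumFields.BalabanUV.Gaps.D4WalkBlockPartitionSum

end
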